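import Literature.Computability.AlgebraicComplexity.BI17GenericTernaryCubicPeriodGuard
import HarnessLib

/-!
# Generic ternary cubics do NOT have a trivial stabilizer — the exception `(D, m) = (3, 3)` of the
# generic-trivial-stabilizer theorem is necessary (BI 2017 §2.1 / Thm. 2.3, App. Prop. 7.5 (1))

Sibling proof file of `Literature/Computability/AlgebraicComplexity/BI17FundamentalInvariantForms.lean`
(cell `val-lit`, DAG row BI2017-A). BI 2017 §2.1 (L428) calls `stab(w) = {ζ I_m | ζ^D = 1}` a
trivial stabilizer (tree: `HasTrivialStabilizer D w`, the inclusion `⊆`); Matsumura–Monsky 1963 /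
BI Thm. 2.3 assert it for generic `w` when `D ≥ 3`, `m ≥ 3`, `(D, m) ≠ (3, 3)` (the programme of
val-lit-x3 g3, `isZariskiGeneric_hasTrivialStabilizer`). Here the necessity of the exception: a form
with trivial stabilizer and `D ∣ m` has stabilizer period `a(w) = 1` (`det(ζ I) = ζ^m = 1`), whereas
every SMOOTH ternary cubic has `a(w) ≠ 1` (`stabilizerPeriod_ne_one_of_forall_regular`: the swap of two
Hesse coordinates has determinant `−1`); with val-lit-p4's generic smoothness
(`isZariskiGeneric_forall_exists_eval_pderiv_ne_zero`) and `IsZariskiGeneric.exists_form`: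
"almost all ternary cubics have trivial stabilizer" is FALSE. Everything PROVED; no definitions, no
facts; nothing here bears on `VP` versus `VNP`.
-/

noncomputable section

open MvPolynomial

namespace Literature.Computability.AlgebraicComplexity

/-- **A trivial stabilizer with `D ∣ m` forces stabilizer period `1`**: every stabilizer element is
`ζ I` with `ζ^D = 1`, so its determinant `ζ^m` is `1` and `det(stab w) = {1}`.
[cite: BurgisserIkenmeyer2017, §2.1 (L428, "trivial stabilizer") and Def. 2.2] -/
theorem stabilizerPeriod_eq_one_of_hasTrivialStabilizer {m D : ℕ} {f : MvPolynomial (Fin m) ℂ}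
    (h : HasTrivialStabilizer D f) (hdvd : D ∣ m) : stabilizerPeriod f = 1 := by
  rw [stabilizerPeriod_def, Subgroup.card_eq_one, eq_bot_iff]
  intro u hu
  rw [mem_stabilizerDetImage_iff] at hu
  obtain ⟨γ, hγ, rfl⟩ := hu
  obtain ⟨ζ, hζ, hγζ⟩ := h γ hγ
  obtain ⟨q, hq⟩ := hdvd
  rw [Subgroup.mem_bot, Units.ext_iff, Matrix.GeneralLinearGroup.val_det_apply, hγζ,
    Matrix.det_smul, Matrix.det_one, mul_one, Fintype.card_fin, hq, pow_mul, hζ, one_pow,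
    Units.val_one]

/-- **A smooth ternary cubic does not have a trivial stabilizer** (its stabilizer period is not `1`).
[cite: BurgisserIkenmeyer2017, App. Prop. 7.5 (1)] -/
theorem not_hasTrivialStabilizer_of_forall_regular {F : MvPolynomial (Fin 3) ℂ}
    (hF : F.IsHomogeneous 3)
    (hreg : ∀ p : Fin 3 → ℂ, p ≠ 0 → eval p F = 0 → (fun i => eval p (pderiv i F)) ≠ 0) :
    ¬ HasTrivialStabilizer 3 F := fun h =>
  stabilizerPeriod_ne_one_of_forall_regular hF hreg
    (stabilizerPeriod_eq_one_of_hasTrivialStabilizer h (dvd_refl 3))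

/-- **"Almost all ternary cubics have a trivial stabilizer" is FALSE** — the exception
`(D, m) = (3, 3)` in BI Thm. 2.3 / Matsumura–Monsky is necessary.
[cite: BurgisserIkenmeyer2017, Thm. 2.3 and App. Prop. 7.5 (1)] -/
theorem not_isZariskiGeneric_hasTrivialStabilizer_three_three :
    ¬ IsZariskiGeneric 3 (fun f : MvPolynomial (Fin 3) ℂ => HasTrivialStabilizer 3 f) := by
  intro h
  obtain ⟨F, hF, htriv, hsm⟩ := IsZariskiGeneric.exists_form
    (h.and (isZariskiGeneric_forall_exists_eval_pderiv_ne_zero (n := 1) (D := 3) (by norm_num)))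
  have hreg : ∀ p : Fin 3 → ℂ, p ≠ 0 → eval p F = 0 → (fun i => eval p (pderiv i F)) ≠ 0 := by
    intro p hp hFp hgrad
    obtain ⟨j, hj⟩ := hsm p hp hFp
    exact hj (congr_fun hgrad j)
  exact not_hasTrivialStabilizer_of_forall_regular hF hreg htriv

end Literature.Computability.AlgebraicComplexity

end
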